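import Literature.Analysis.Matrix.InertiaSigmaMin
import HarnessLib

/-!
# The augmented-inertia certificate in PIVOT coordinates (Terao–Ozaki Lemma 1 / Rump Part II (1.4),
# as a sparse verifier actually checks it)

Topic `Analysis/Matrix`; namespace `Literature.Analysis.Matrix.AugmentedInertiaCertificate`.
HONEST FRAMING (cell certnum, CERTIFIED-NUMERICS STACK, D-0105 (6); layer L1 interval linear algebra; seat
certnum-ila-1, author of the engine kernel `cap.ila.gen.sigma_min_lower_aug`, certificate kind
`sparse-aug-inertia/1`): this cell ships TOOLS and SOUNDNESS STATEMENTS; every certified number belongs to a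
client cell's ledger. A typed and PROVED composition; it certifies no engine output. 0 definitions, 0 named
facts, 0 `sorry`.

THE PRINTED METHOD (as typed by certnum-lit-1 in `InertiaSigmaMin.sigma_lower_of_augmented_inertia`): for a
real square `A`, `B := [[0, Aᵀ],[A, 0]]`; one `LDLᵀ`-type certificate `B + θ·1 − Δ = S·diag(d)·Sᵀ` with
`det S` a unit, no zero pivot, as many positive as negative pivots, and `xᵀΔx ≤ ρ·xᵀx` gives
`(θ − ρ)‖v‖₂ ≤ ‖Av‖₂` for all `v`. [cite: TeraoOzaki2025, Lemma 1 (7)] [cite: Rump2026SparseII, (1.4)]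

WHAT A SPARSE VERIFIER ACTUALLY HOLDS (cap.ila ≥ 0.2.1.dev29; Terao–Ozaki §3, Rump Part I Table 6): the
factorisation is computed for the PERMUTED matrix `H(p,p)`, `H := B + θ·1`, along a fill-reducing pivot
order `p` (a bijection from pivot POSITIONS `κ` — in practice `Fin (2n)` — onto the index set `ι ⊕ ι`), and
what is stored is: a block lower triangular `G` (positions × positions, `= fl(L·D̂)`), a SIGNATURE vector
`s ∈ {±1}^κ` (the signs of the block pivots), and a rigorous bound `ρ` on `‖H(p,p) − G·diag(s)·Gᵀ‖₂`
obtained from an entrywise majorant by the Collatz bound of [Rump2026SparseI] (1.8)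
(`SparseLUSplit.norm_toLp_mulVec_le_sqrt_of_abs_le_collatz`, stated over `Fin m`). This file is the glue
between that data and the printed theorem, so that the certificate's `soundness` field names ONE decl whose
hypothesis list IS the replay checklist (the §1 transport / Cauchy–Schwarz lemmas are private plumbing):
* `sigma_lower_of_augmented_certificate` — for ANY equivalence `e : κ ≃ ι ⊕ ι` (the pivot order): if
  `(B + θ·1).submatrix e e = G·diagonal s·Gᵀ + Δ` (exact identity DEFINING `Δ` in pivot coordinates),
  `det G` is a unit, every `s k = ±1` with as many `+1` as `−1`, and `‖Δy‖₂ ≤ ρ‖y‖₂` for all `y`, then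
  `(θ − ρ)‖v‖₂ ≤ ‖Av‖₂` for every `v`;
* `isUnit_det_and_norm_inv_mulVec_sub_le_of_augmented_certificate` — hence, for `ρ < θ`, `A` is
  nonsingular and `‖A⁻¹b − x̃‖₂ ≤ ‖b − Ax̃‖₂/(θ − ρ)` for all `b`, `x̃` (the use made of it: the `σ_lo` of an
  `ila-lss/1` enclosure).
Proof = transport along `e` (`submatrix` algebra: `submatrix_mul_equiv`, `submatrix_diagonal_equiv`,
`det_submatrix_equiv_self`, `submatrix_mulVec_equiv`), the Cauchy–Schwarz step from the NORM bound on `Δ` to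
the FORM bound the printed theorem wants (`real_inner_le_norm`), and certnum-lit-1's theorem. The block
structure of `G` (why `det G ≠ 0` is checkable from its diagonal blocks) is Mathlib's
`Matrix.BlockTriangular.det`; the floating-point production of `ρ` is [Rump2026SparseI] (1.8) — both are
CITED by the kernel, not restated here.

NOT HERE: how `G`, `s`, `ρ` are produced (cap.ila.bkldl is a proposal generator; the EFT residual and the
Collatz bound are the kernel's hypotheses H-IEEE/H-EFT/H-SPMM); rectangular `A`; complex data.

## Search record (TYPER LINT RULE)
`lean search 'sigma_lower_of_augmented|augmented_certificate'` → only certnum-lit-1's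
`InertiaSigmaMin.sigma_lower_of_augmented_inertia` / `norm_inv_mulVec_sub_le_of_augmented_inertia`
(CITED and USED below, not restated: they take the certificate in ORIGINAL coordinates with a FORM bound).

AI-produced formalisation (cell certnum, seat certnum-ila-1 gen 5, 2026-08-27).
-/

noncomputable section

open scoped Matrix

namespace Literature.Analysis.Matrix

namespace AugmentedInertiaCertificate

open Finset _root_.Matrix WithLp

variable {ι κ : Type*} [Fintype ι] [DecidableEq ι] [Fintype κ] [DecidableEq κ]

/-! ### §1 Transport of vectors and forms along the pivot order -/

omit [DecidableEq ι] [DecidableEq κ] in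
/-- `x ⬝ᵥ (f ∘ e⁻¹) = (x ∘ e) ⬝ᵥ f` for an equivalence `e : κ ≃ ι'` (re-indexing a dot product).
[folklore] -/
private theorem dotProduct_comp_symm {ι' : Type*} [Fintype ι'] (e : κ ≃ ι') (x : ι' → ℝ) (f : κ → ℝ) :
    x ⬝ᵥ (f ∘ e.symm) = (x ∘ e) ⬝ᵥ f := by
  simp only [dotProduct, Function.comp_apply]
  exact (Fintype.sum_equiv e (fun k => x (e k) * f k) (fun i => x i * f (e.symm i))
    (fun k => by rw [Equiv.symm_apply_apply])).symm

omit [DecidableEq κ] in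
/-- The Euclidean norm of `toLp 2 v` squared is the dot product `v ⬝ᵥ v`. [folklore] -/
private theorem norm_toLp_sq_eq_dotProduct (y : κ → ℝ) : ‖toLp 2 y‖ ^ 2 = y ⬝ᵥ y := by
  rw [EuclideanSpace.norm_sq_eq]
  simp only [dotProduct, Real.norm_eq_abs, sq, abs_mul_abs_self]

omit [DecidableEq κ] in
/-- **Cauchy–Schwarz glue:** a NORM bound `‖Δy‖₂ ≤ ρ‖y‖₂` (all `y`) gives the FORM bound
`yᵀΔy ≤ ρ·yᵀy` (all `y`) that the printed inertia theorem consumes. [folklore] -/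
private theorem dotProduct_mulVec_le_of_norm_mulVec_le {Δ : Matrix κ κ ℝ} {ρ : ℝ}
    (hΔ : ∀ y : κ → ℝ, ‖toLp 2 (Δ *ᵥ y)‖ ≤ ρ * ‖toLp 2 y‖) (y : κ → ℝ) :
    y ⬝ᵥ (Δ *ᵥ y) ≤ ρ * (y ⬝ᵥ y) := by
  have h1 : y ⬝ᵥ (Δ *ᵥ y) = inner ℝ (toLp 2 (Δ *ᵥ y)) (toLp 2 y) := by
    rw [EuclideanSpace.inner_toLp_toLp, star_trivial]
  have h2 : inner ℝ (toLp 2 (Δ *ᵥ y)) (toLp 2 y) ≤ ‖toLp 2 (Δ *ᵥ y)‖ * ‖toLp 2 y‖ :=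
    real_inner_le_norm _ _
  have h3 : ‖toLp 2 (Δ *ᵥ y)‖ * ‖toLp 2 y‖ ≤ ρ * ‖toLp 2 y‖ * ‖toLp 2 y‖ :=
    mul_le_mul_of_nonneg_right (hΔ y) (norm_nonneg _)
  rw [h1]
  calc inner ℝ (toLp 2 (Δ *ᵥ y)) (toLp 2 y) ≤ ρ * ‖toLp 2 y‖ * ‖toLp 2 y‖ := h2.trans h3
    _ = ρ * (y ⬝ᵥ y) := by rw [mul_assoc, ← sq, norm_toLp_sq_eq_dotProduct]

/-! ### §2 The certificate in pivot coordinates -/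

section Certificate

variable {A : Matrix ι ι ℝ} {G Δ : Matrix κ κ ℝ} {s : κ → ℝ} {θ ρ : ℝ}

/-- **Terao–Ozaki Lemma 1 / Rump Part II (1.4) for the certificate a sparse verifier STORES.** Let `A` be a
real square matrix, `B := [[0, Aᵀ],[A, 0]]`, `e : κ ≃ ι ⊕ ι` the pivot order (positions ↦ indices), and
suppose, in PIVOT coordinates, `(B + θ·1)(p,p) = G·diag(s)·Gᵀ + Δ` exactly, with `det G` a unit, every
`s k ∈ {1, −1}`, as many `+1` as `−1`, and `‖Δy‖₂ ≤ ρ‖y‖₂` for all `y`. Then `(θ − ρ)‖v‖₂ ≤ ‖Av‖₂` for every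
`v` — i.e. `σ_min(A) ≥ θ − ρ`. [cite: TeraoOzaki2025, Lemma 1 (7)] [cite: Rump2026SparseII, (1.4) and §6]
[cite: Rump2026SparseI, Section 1 (1.8)] -/
theorem sigma_lower_of_augmented_certificate (e : κ ≃ ι ⊕ ι)
    (hH : (fromBlocks 0 Aᵀ A 0 + θ • (1 : Matrix (ι ⊕ ι) (ι ⊕ ι) ℝ)).submatrix e e =
      G * diagonal s * Gᵀ + Δ)
    (hG : IsUnit G.det) (hs : ∀ k, s k = 1 ∨ s k = -1)
    (hcount : Fintype.card {k // 0 < s k} = Fintype.card {k // s k < 0})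
    (hΔ : ∀ y : κ → ℝ, ‖toLp 2 (Δ *ᵥ y)‖ ≤ ρ * ‖toLp 2 y‖) (v : ι → ℝ) :
    (θ - ρ) * ‖toLp 2 v‖ ≤ ‖toLp 2 (A *ᵥ v)‖ := by
  -- the certificate transported to ORIGINAL coordinates
  set S : Matrix (ι ⊕ ι) (ι ⊕ ι) ℝ := G.submatrix e.symm e.symm with hSdef
  set d : ι ⊕ ι → ℝ := s ∘ e.symm with hddef
  set Δ' : Matrix (ι ⊕ ι) (ι ⊕ ι) ℝ := Δ.submatrix e.symm e.symm with hΔdef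
  have hback : fromBlocks 0 Aᵀ A 0 + θ • (1 : Matrix (ι ⊕ ι) (ι ⊕ ι) ℝ) = S * diagonal d * Sᵀ + Δ' := by
    have h1 : ((fromBlocks 0 Aᵀ A 0 + θ • (1 : Matrix (ι ⊕ ι) (ι ⊕ ι) ℝ)).submatrix e e).submatrix e.symm e.symm
        = (G * diagonal s * Gᵀ + Δ).submatrix e.symm e.symm := by rw [hH]
    rw [submatrix_submatrix, Equiv.self_comp_symm, submatrix_id_id] at h1
    rw [h1, submatrix_add, Pi.add_apply, Pi.add_apply, hSdef, hddef, hΔdef,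
      ← submatrix_mul_equiv (G * diagonal s) Gᵀ e.symm e.symm e.symm,
      ← submatrix_mul_equiv G (diagonal s) e.symm e.symm e.symm, submatrix_diagonal_equiv,
      transpose_submatrix]
  have hcert : fromBlocks 0 Aᵀ A 0 - Δ' - (-θ) • (1 : Matrix (ι ⊕ ι) (ι ⊕ ι) ℝ) = S * diagonal d * Sᵀ := by
    rw [neg_smul, sub_neg_eq_add, sub_add_eq_add_sub, hback, add_sub_cancel_right]
  have hS : IsUnit S.det := by
    rw [hSdef, det_submatrix_equiv_self]; exact hG
  have hd : ∀ i, d i ≠ 0 := fun i => by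
    rcases hs (e.symm i) with h | h <;> simp [hddef, h]
  have hcount' : Fintype.card {i // 0 < d i} = Fintype.card {i // d i < 0} := by
    have hp : Fintype.card {i : ι ⊕ ι // 0 < d i} = Fintype.card {k : κ // 0 < s k} :=
      Fintype.card_congr (Equiv.subtypeEquiv e.symm fun i => Iff.rfl)
    have hn : Fintype.card {i : ι ⊕ ι // d i < 0} = Fintype.card {k : κ // s k < 0} :=
      Fintype.card_congr (Equiv.subtypeEquiv e.symm fun i => Iff.rfl)
    rw [hp, hn, hcount]
  have hform : ∀ x : ι ⊕ ι → ℝ, x ⬝ᵥ Δ' *ᵥ x ≤ ρ * (x ⬝ᵥ x) := by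
    intro x
    have hmv : Δ' *ᵥ x = (Δ *ᵥ (x ∘ e)) ∘ e.symm := by
      rw [hΔdef, submatrix_mulVec_equiv, Equiv.symm_symm]
    have hxx : x ⬝ᵥ x = (x ∘ e) ⬝ᵥ (x ∘ e) := by
      have := dotProduct_comp_symm e x (x ∘ e)
      rwa [show (x ∘ e) ∘ e.symm = x from by ext i; simp] at this
    rw [hmv, dotProduct_comp_symm, hxx]
    exact dotProduct_mulVec_le_of_norm_mulVec_le hΔ (x ∘ e)
  exact InertiaSigmaMin.sigma_lower_of_augmented_inertia hS hcert hd hform hcount' v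

/-- Hence `ρ < θ` proves `A` nonsingular with `‖A⁻¹b − x̃‖₂ ≤ ‖b − Ax̃‖₂/(θ − ρ)` — the `σ_lo = θ − ρ` of an
`ila-lss/1` enclosure (cap.ila certificate kind `sparse-aug-inertia/1`).
[cite: TeraoOzaki2025, Lemma 1 (7)] [cite: Rump2026SparseII, §1 p. 3] -/
theorem isUnit_det_and_norm_inv_mulVec_sub_le_of_augmented_certificate (e : κ ≃ ι ⊕ ι)
    (hH : (fromBlocks 0 Aᵀ A 0 + θ • (1 : Matrix (ι ⊕ ι) (ι ⊕ ι) ℝ)).submatrix e e =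
      G * diagonal s * Gᵀ + Δ)
    (hG : IsUnit G.det) (hs : ∀ k, s k = 1 ∨ s k = -1)
    (hcount : Fintype.card {k // 0 < s k} = Fintype.card {k // s k < 0})
    (hΔ : ∀ y : κ → ℝ, ‖toLp 2 (Δ *ᵥ y)‖ ≤ ρ * ‖toLp 2 y‖) (hθ : ρ < θ) (b xt : ι → ℝ) :
    IsUnit A.det ∧ ‖toLp 2 (A⁻¹ *ᵥ b - xt)‖ ≤ ‖toLp 2 (b - A *ᵥ xt)‖ / (θ - ρ) :=
  ⟨SingularValueVerification.isUnit_det_of_sigma_lower (sub_pos.2 hθ)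
      (sigma_lower_of_augmented_certificate e hH hG hs hcount hΔ),
    SingularValueVerification.norm_toLp_inv_mulVec_sub_le (sub_pos.2 hθ)
      (sigma_lower_of_augmented_certificate e hH hG hs hcount hΔ) b xt⟩

end Certificate

end AugmentedInertiaCertificate

end Literature.Analysis.Matrix
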